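import Mathlib
import Literature.LinearAlgebra.MeshulamBoundedRank
import Literature.Combinatorics.Optimization.KonigLineCover
import HarnessLib

/-!
# Meshulam 1985: Theorem 1 AS PRINTED (rank `≥ ρ(𝒜)`, the line-cover number of the leading positions,
# via the tree's Kőnig theorem) and the rectangular form of Theorem 2 (`dim W ≤ r·max(n,p)`) — PROVED

Topic `Literature/LinearAlgebra`; a small sequel of `MeshulamMaximalRank.lean` / `MeshulamBoundedRank.lean`
(cell qa-qnc0, seat qa-qnc0-lit gen 10: Theorem 1 "in the form used for Theorem 2" =
`Meshulam.exists_rank_ge_of_leading_indep`, and the discharge `Meshulam1985_exists_rank_gt_holds` of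
THEOREM 2) written by seat `pub-hodgecm2-infra07f1` gen 72, whose own discharge of the same fact
(p499702, Kőnig via Hall) lost the race to p500201 and is NOT re-filed; only the two statements the tree
does not yet have are added here, both proved from the landed declarations (nothing re-declared, no
named fact, no definition).

## The source, verbatim (held `paper:doi-10-1093-qmath-36-2-225`, bib key `Meshulam1985`, pp. 225–226 read)

p. 225: «For `A ∈ M_n(F)` denote by `p(A) ∈ [n] × [n]` the location of `A`'s lexicographically first non-zero
entry … For a collection `𝒜 = {A_1, …, A_m}` of `n × n` matrices, construct an `n × n` matrix `B` as follows:
`B(k, l) = 1` if `(k, l) = p(A_i)` for some `1 ≤ i ≤ m`, and `B(k, l) = 0` otherwise.  Denote by `ρ(𝒜)` the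
minimal number of lines in `B` (a line is either a row or a column) which cover all 1's in `B`.
**THEOREM 1.** Let `𝒜 = {A_1, …, A_m} ⊆ M_n(F)`. Then `span 𝒜` contains a matrix of rank `≥ ρ(𝒜)`.
*Proof.* … By König's Theorem ([4], Theorem 5.1.4 in [3]), the maximal size of an independent set of 1's in
a 0-1 matrix, is equal to the minimal number of lines, which cover all 1's in that matrix. Hence if
`ρ(𝒜) = r`, then there exist `1 ≤ i_1, …, i_r ≤ m` such that `{p(A_{i_j}) : 1 ≤ j ≤ r}` is independent» —
the rest of the proof is `Meshulam.exists_rank_ge_of_leading_indep`.  The Kőnig step is the tree's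
`Literature.Combinatorics.Optimization.KonigLineCover.termRank_eq_lineCoverNumber` (Brualdi–Ryser Thm 1.2.1),
`ρ(𝒜) = lineCoverNumber` of the set of leading positions.

Rectangular matrices: C. de Seguins Pazzis, Israel J. Math. 208 (2015) = arXiv:1004.0298 (held), §1 (p. 2 of
the arXiv text): «This theorem was later generalized by Flanders to subspaces of `Mat_{n,p}(𝕂)` with rank
`≤ r` in the case `card 𝕂 > r`, proving in particular that such a subspace must have a dimension lesser or
equal to `r·max(n,p)` (later, Meshulam generalized this to an arbitrary field …)» — obtained here from the
square THEOREM 2 by zero-padding to square matrices of size `max(n,p)` (the `TODO(general form)` recorded in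
`MeshulamBoundedRank.lean`).

## Contents (all proved; no `def`)

* `Meshulam1985.exists_enum_of_isScattered` — a scattered set of cells listed with injective rows/columns.
* `Meshulam1985.theorem1` — THEOREM 1 as printed: `span{A_i}` contains a matrix of rank
  `≥ lineCoverNumber {p(A_i)}`, the `A_i` given with their leading data at positions `q i`.
* `Meshulam1985.exists_rank_gt_rect`, `Meshulam1985.finrank_le_mul_max_of_forall_rank_le` — the rectangular
  THEOREM 2 and its contrapositive `dim W ≤ r·max(n,p)`.
* `Meshulam1985.finrank_le_mul_of_forall_rank_le` — the square contrapositive, unconditionally (feeds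
  `Meshulam1985_exists_rank_gt_holds` to the conditional corollary of `MeshulamBoundedRank.lean`).

WHAT THIS IS NOT: Theorem 3 (the equality case) is not formalised; nothing here bears on any summit statement.
-/

namespace Literature.LinearAlgebra.Meshulam1985

open Module Matrix Finset
open Literature.Combinatorics.Optimization.KonigLineCover

variable {F : Type*} [Field F]

/-- A scattered set of cells of an `n × n` grid («independent: no two entries on the same line», p. 225),
enumerated: `#T` cells `(σ j, τ j)` with `σ` (rows, listed increasingly) and `τ` (columns) injective.
[cite: Meshulam1985, Thm. 1, proof (p. 225: "Let p(A_{i_j}) = (k_j, l_j) … S and T are both of cardinality r")] -/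
theorem exists_enum_of_isScattered {n : ℕ} (T : Finset (Fin n × Fin n)) (hT : IsScattered T) :
    ∃ σ τ : Fin T.card → Fin n, StrictMono σ ∧ Function.Injective τ ∧ ∀ j, (σ j, τ j) ∈ T := by
  classical
  have hinj : Set.InjOn Prod.fst (T : Set (Fin n × Fin n)) :=
    fun x hx y hy hxy => hT.1 x hx y hy hxy
  have hcard : (T.image Prod.fst).card = T.card := Finset.card_image_of_injOn hinj
  set σ' := (T.image Prod.fst).orderEmbOfFin hcard with hσ'
  have hrow : ∀ j : Fin T.card, ∃ c : Fin n, (σ' j, c) ∈ T := by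
    intro j
    have := Finset.orderEmbOfFin_mem (T.image Prod.fst) hcard j
    obtain ⟨x, hx, hx1⟩ := Finset.mem_image.1 this
    exact ⟨x.2, by rwa [← hx1]⟩
  choose τ hτ using hrow
  refine ⟨fun j => σ' j, τ, σ'.strictMono, ?_, hτ⟩
  intro j j' h
  have := hT.2 _ (hτ j) _ (hτ j') (by simpa using h)
  exact σ'.injective (Prod.ext_iff.1 this).1

/-- **Meshulam 1985, THEOREM 1 (as printed).**  Let `A_1, …, A_t ∈ M_n(F)` have lexicographic leading
entries at the positions `q i = p(A_i)` (given as leading data: the rows above `(q i).1` vanish, row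
`(q i).1` vanishes left of `(q i).2`, and `A_i (q i) ≠ 0`).  Then `span{A_i}` contains a matrix of rank
`≥ ρ(𝒜)`, where `ρ(𝒜) = lineCoverNumber {q i}` is the minimal number of lines covering the leading positions.
Proof as printed: by Kőnig's theorem (tree `termRank_eq_lineCoverNumber`) there are `ρ(𝒜)` independent leading
positions; conclude by `Meshulam.exists_rank_ge_of_leading_indep` (the rest of the printed proof).
[cite: Meshulam1985, Thm. 1 (p. 225)] [cite: BrualdiRyser1991, Theorem 1.2.1 (Kőnig)] -/
theorem theorem1 {n t : ℕ} (A : Fin t → Matrix (Fin n) (Fin n) F) (q : Fin t → Fin n × Fin n)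
    (hlead : ∀ i, (∀ i', i' < (q i).1 → A i i' = 0) ∧ (∀ c, c < (q i).2 → A i (q i).1 c = 0) ∧
      A i (q i).1 (q i).2 ≠ 0) :
    ∃ B ∈ Submodule.span F (Set.range A), lineCoverNumber (Finset.univ.image q) ≤ B.rank := by
  classical
  set S := Finset.univ.image q with hS
  obtain ⟨T, hTS, hT, hTcard⟩ := exists_card_eq_termRank S
  rw [termRank_eq_lineCoverNumber] at hTcard
  obtain ⟨σ, τ, hσ, hτ, hmem⟩ := exists_enum_of_isScattered T hT
  have hex : ∀ j : Fin T.card, ∃ i : Fin t, q i = (σ j, τ j) := by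
    intro j
    have := hTS (hmem j)
    simpa [hS, eq_comm] using this
  choose ι hι using hex
  have hk : ∀ j, (q (ι j)).1 = σ j := fun j => by rw [hι j]
  have hl : ∀ j, (q (ι j)).2 = τ j := fun j => by rw [hι j]
  obtain ⟨x, hx⟩ := Meshulam.exists_rank_ge_of_leading_indep (fun j => A (ι j)) σ τ hσ.injective hτ
    (fun j => by rw [← hk j, ← hl j]; exact (hlead (ι j)).2.2)
    (fun j i hi => (hlead (ι j)).1 i (by rw [hk j]; exact hi))
    (fun j c hc => by rw [← hk j]; exact (hlead (ι j)).2.1 c (by rw [hl j]; exact hc))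
  exact ⟨∑ j, x j • A (ι j), Submodule.sum_mem _ fun j _ =>
    Submodule.smul_mem _ _ (Submodule.subset_span ⟨ι j, rfl⟩), hTcard ▸ hx⟩

/-- **The contrapositive of THEOREM 2, unconditionally:** over any field, a linear space of `n × n` matrices
all of rank `≤ r` has dimension `≤ r·n` (the conditional `Literature.LinearAlgebra.finrank_le_mul_of_forall_rank_le`
fed with the landed discharge `Meshulam1985_exists_rank_gt_holds`).
[cite: Meshulam1985, Thm. 2 (p. 226), contrapositive] -/
theorem finrank_le_mul_of_forall_rank_le {n r : ℕ} (W : Submodule F (Matrix (Fin n) (Fin n) F))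
    (hW : ∀ A ∈ W, A.rank ≤ r) : finrank F W ≤ r * n :=
  Literature.LinearAlgebra.finrank_le_mul_of_forall_rank_le (Meshulam1985_exists_rank_gt_holds F) W hW

/-- **THEOREM 2 for rectangular matrices** (Flanders' bound over an arbitrary field): a linear subspace
`W ≤ M_{n,p}(F)` with `dim W > r·max(n,p)` contains a matrix of rank `> r` — from the square theorem by
zero-padding `A ↦ E A E'ᵀ` into `M_N(F)`, `N = max(n,p)` (dimension-preserving, rank-non-increasing).
[cite: deSeguinsPazzis2015, §1 (arXiv:1004.0298 p. 2: "dimension lesser or equal to r·max(n,p) … Meshulam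
generalized this to an arbitrary field")] [cite: Meshulam1985, Thm. 2 (p. 226)] -/
theorem exists_rank_gt_rect {n p r : ℕ} (W : Submodule F (Matrix (Fin n) (Fin p) F))
    (hW : r * max n p < finrank F W) : ∃ A ∈ W, r < A.rank := by
  classical
  set N := max n p with hN
  have hn : n ≤ N := le_max_left n p
  have hp : p ≤ N := le_max_right n p
  -- zero-padding `A ↦ E A E'ᵀ`
  set E : Matrix (Fin N) (Fin n) F := Matrix.of fun i k => if i = Fin.castLE hn k then 1 else 0
    with hE
  set E' : Matrix (Fin N) (Fin p) F := Matrix.of fun j l => if j = Fin.castLE hp l then 1 else 0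
    with hE'
  let ι : Matrix (Fin n) (Fin p) F →ₗ[F] Matrix (Fin N) (Fin N) F :=
    { toFun := fun A => E * A * E'ᵀ
      map_add' := fun A B => by rw [Matrix.mul_add, Matrix.add_mul]
      map_smul' := fun c A => by
        rw [Matrix.mul_smul, Matrix.smul_mul, RingHom.id_apply] }
  have hι : ∀ A, ι A = E * A * E'ᵀ := fun A => rfl
  have hkey : ∀ A : Matrix (Fin n) (Fin p) F,
      (ι A).submatrix (Fin.castLE hn) (Fin.castLE hp) = A := by
    intro A
    ext k l
    simp only [hι, Matrix.submatrix_apply, Matrix.mul_apply, hE, hE', Matrix.of_apply,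
      Matrix.transpose_apply, Fin.castLE_inj]
    simp [Finset.sum_ite_eq]
  have hinj : Function.Injective ι := fun A B h => by rw [← hkey A, ← hkey B, h]
  have hdim : r * N < finrank F (W.map ι) := by
    rwa [← (Submodule.equivMapOfInjective ι hinj W).finrank_eq]
  obtain ⟨B, hB, hrB⟩ := Meshulam1985_exists_rank_gt_holds F N r (W.map ι) hdim
  obtain ⟨A, hA, rfl⟩ := Submodule.mem_map.1 hB
  refine ⟨A, hA, lt_of_lt_of_le hrB ?_⟩
  rw [hι]
  exact (Matrix.rank_mul_le_left _ _).trans (Matrix.rank_mul_le_right _ _)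

/-- The contrapositive for rectangular matrices: over any field, a linear space of `n × p` matrices all of
rank `≤ r` has dimension `≤ r·max(n,p)`. [cite: deSeguinsPazzis2015, §1 (arXiv:1004.0298 p. 2)]
[cite: Meshulam1985, Thm. 2 (p. 226), contrapositive] -/
theorem finrank_le_mul_max_of_forall_rank_le {n p r : ℕ} (W : Submodule F (Matrix (Fin n) (Fin p) F))
    (hW : ∀ A ∈ W, A.rank ≤ r) : finrank F W ≤ r * max n p := by
  by_contra hlt
  obtain ⟨A, hA, hr⟩ := exists_rank_gt_rect W (lt_of_not_ge hlt)
  exact absurd (hW A hA) (not_le.2 hr)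

end Literature.LinearAlgebra.Meshulam1985
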